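import Summits.HubbardSuperconductivity.HubbardSuperconductivity.Theses.ColourTheSpin
import Literature.MathematicalPhysics.QuantumLattice.PairFieldEvenSideLRO

/-!
# Crux `SgEndpoint` (stmt-HubbardSuperconductivity-16272, route `ColourTheSpin`, rank 2) —
# ALT LINE `Lines/penalty-chord.lean` (crux-strategist, 2026-08-17): the endpoint in ENERGY
# currency — disfavouring pair source, κ-chord through g → 0⁺, every ground state priced

The crux by name (`Theses.ColourTheSpin.SgEndpoint`): pointwise in `(U,δ)`, corridor order of the
`Q₈`-spin-gauged torus (every ground state of the `N_L`-block of `H_g` has `⟨P†P⟩ ≥ c'L⁴‖ψ‖²`,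
`g ∈ (0,g₀]`, even `L ≥ L₁`) ⇒ the summit's matrix at `(U,δ)`.

## Why a second line (what it dodges in `Lines/birth.lean`)

The birth line passes ground STATES to the limit `g → 0⁺`; states SELECT (strategist census §F1:
within the ground eigenspace of the frozen Hamiltonian the limit lands on the extremisers of the
kinetic energy, at order `g⁸`), so it needs `stub_someToEveryGroundState` (some ⇒ every; kind (A),
dead ×19 seats on the sibling `BirEveryGroundState`) and `stub_trivialTwistSelection` (the zero-twist
class is the STRICT energy floor among the 22 flat classes; implausible: `−1` twists are a full pair
flux quantum, split from the trivial class only by `O(1/L)` nodal terms of either sign). This line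
passes ground-state ENERGIES to the limit instead — they do not select:

  `e(κ) ≤ E₀^N(H_g + κY) ≤ e(κ) + (7/8) g² |Bond L|`   (`g ≤ g_*(L,U,κ)`),
  `e(κ) := min_{k flat} min Rayleigh_N (H_F(k) + κ Y_k)`, `Y = L⁻⁴ P†P` (block-diagonal in `k`),

because `E = Σ_b E_b ≥ 0`, the magnetic weight is `≥ 1` off the flat sector and `A`, `Y` are
block-diagonal in the link configuration. A DISFAVOURING pair source `+κY` (`κ > 0`) makes the every-
ground-state content an energy: for every ground state `ψ` of `H`,
`κ⟨Y⟩_ψ ≥ E₀(H + κY) − E₀(H)` (Kaplan–Horsch–von der Linden). Hence, IF the corridor order is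
available for the PENALISED gauged Hamiltonian `H_g + κY` (stub P1, the line's bet), the chord
`E₀(H_g+κY) − E₀(H_g) ≥ κc₁` passes to `g → 0⁺` as `e(κ) − e(0) ≥ κc₁`, and prices EVERY `N`-block
ground state `φ` of the trivial flat class (`H_F(1) = hubbardTorus 2 L 1 U`, `L ≥ 3`):
`κ⟨Y_1⟩_φ ≥ e(κ) − e₀(1) ≥ κc₁ − [e₀(1) − e(0)]`. The bracket is the TWIST GAP (how far below the
periodic torus a spin-twisted one can sit); stub P2 says it is `o(1)`; then `⟨Y_1⟩_φ ≥ c₁/2`, i.e.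
`Re⟨Δ_d†Δ_d⟩ ≥ c₁ L⁴` for every sector ground state (sector = block ground energy by `SU(2)`,
landed `groundEnergyAt_eq_minEnergyOn_szSector`; `P_1 = Δ_d/√2`, landed
`spinGaugedPairField_apply_one_one`) — stub P3, PROVABLE NOW — and the landed even-side
bookkeeping closes. No selection, no homogeneity, no strict twist floor.

Stubs (3; sorry count = 3): `stub_penaltyUpgrade` (P1, crux-kind, the bet: every-GS corridor order ⇒
penalised corridor order, on the gauged side), `stub_twistGap` (P2, open, mild), `stub_penalisedEndpoint`
(P3, provable now, XL). Their signatures `Sig.stub_*` are CLOSED Props self-contained over the route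
file's imports (the gauged objects inlined exactly as in the parent item) — the same texts the
strategist filed as `children.json` for the eventual `route edit --split SgEndpoint` (bounced today only
by the final-cycle rule), so a tenure split can reuse them 1:1. Composition `SgEndpoint_of` is the
strategist's kernel-checked glue (also attached as `Split.lean` = candidate
`Theorems/ColourTheSpinSgEndpointSplit.lean`).

Disproof used: none exists for this crux (no `Disproof.lean`, no `Theorems/SgEndpoint/Negative/*`,
2026-08-17); negatives index (stmt-1180, stmt-1314) untouched. BC7 probes of the three stub texts
(`Probe.lean`, route := ColourTheSpin): P1 not provable-cheap, P2 hypotheses not vacuous, P5 no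
`→ summit`; VERDICT CLEAN ×3 (P3 rigidity battery timed out at 45 s — reported, not a pass).
-/

noncomputable section

-- `Summit.<Summit>.<Problem>`: for the single-conjunct summit the duplicate component is mandated.
set_option linter.dupNamespace false
set_option linter.style.longLine false

namespace Summit.HubbardSuperconductivity.HubbardSuperconductivity.Cruxes.SgEndpoint.PenaltyChord

section Verbatim

-- exactly the `open`s of the route file `Theses/ColourTheSpin.lean`, so that the texts below
-- elaborate to the same terms as the route items
open scoped BigOperators Topology Manifold Classical MeasureTheory ProbabilityTheory Matrix InnerProductSpace ComplexConjugate ContinuousMap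
open Filter Set Function TopologicalSpace MeasureTheory
open Literature.Hubbard

/-- STUB P1 SIGNATURE — PENALTY UPGRADE ON THE GAUGED SIDE (the line's bet; kind (B)). Pointwise in
`(U,δ)`: the corridor antecedent of `SgEndpoint` (verbatim) ⇒ for some `g₁, c₁, κ > 0`, `L₂`: every
ground state of the `N_L`-block of the PENALISED gauged Hamiltonian `H_g + (κ/L⁴)·P†P` has
`⟨P†P⟩ ≥ c₁L⁴‖ψ‖²` for `g ∈ (0,g₁]`, even `L ≥ L₂` (equivalently the `κ`-chord
`E₀(H_g+κY) − E₀(H_g) ≥ κc₁`). Why it might fail: hypothesis-idle in substance — brightness of the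
ground states of `H_g` prices no competitor; a `Δ`-dark low-lying state (phase-twisted condensate,
excess `≈ 2π²ρ_s`) becomes THE ground state of `H_g + κY` once `κc₁` exceeds that excess, which nothing
in the antecedent bounds below; abstractly false (dark-partner pencils). Its honest home is the route's
corridor TARGET re-typed in penalised form (census §DOOR). [cite: KaplanHorschVonDerLinden1989]
[cite: doi:10.1103/physrevd.19.3682] -/
def Sig.stub_penaltyUpgrade : Prop :=
  open Literature.MathematicalPhysics.QuantumLattice in ∀ (U δ g₀ c' : ℝ) (L₁ : ℕ), 0 < U → δ ∈ Set.Ioo (0 : ℝ) (1 / 2) → 0 < g₀ → 0 < c' → (∀ g : ℝ, 0 < g → g ≤ g₀ → ∀ (L : ℕ) [NeZero L], L₁ ≤ L → Even L → (let m : Fin 2 × ZMod 4 → Fin 2 × ZMod 4 → Fin 2 × ZMod 4 := fun u v => (u.1 + v.1, if u.1 = 0 then (if v.1 = 0 then u.2 + v.2 else v.2 - u.2) else if v.1 = 0 then u.2 + v.2 else 2 + v.2 - u.2); let iv : Fin 2 × ZMod 4 → Fin 2 × ZMod 4 := fun u => (u.1, if u.1 = 0 then -u.2 else u.2 + 2);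 let r : Fin 2 × ZMod 4 → Fin 2 → Fin 2 → ℂ := fun u σ τ => if u.1 = 0 then (if σ = τ then (if σ = 0 then Complex.I else -Complex.I) ^ u.2.val else 0) else if σ = τ then 0 else if σ = 0 then -(-Complex.I) ^ u.2.val else Complex.I ^ u.2.val; let hop := ∑ b : GaugedHubbard.Bond L, ∑ σ : Fin 2, ∑ τ : Fin 2, Matrix.kroneckerMap (· * ·) (creation (orb b.1 σ) * annihilation (orb (b.1.shift b.2) τ)) (Matrix.diagonal fun k : GaugedHubbard.Bond L → Fin 2 × ZMod 4 => r (k b) σ τ); let H := -(hop + hopᴴ) + ((U : ℝ) : ℂ) • Matrix.kroneckerMap (· * ·) (∑ x : FermionTorus 2 L, numberOp x 0 * numberOp x 1) (1 : Matrix (GaugedHubbard.Bond L → Fin 2 × ZMod 4) (GaugedHubbard.Bond L → Fin 2 × ZMod 4) ℂ) + ((g ^ 2 : ℝ) : ℂ) • Matrix.kroneckerMap (· * ·) (1 : Matrix (Finset (Orb (FermionTorus 2 L))) _ ℂ) (∑ b : GaugedHubbard.Bond L, Matrix.of fun k k' : GaugedHubbard.Bond L → Fin 2 × ZMod 4 =>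 if k' = Function.update k b (k' b) then (if k b = k' b then (1 : ℂ) else 0) - 1 / 8 else 0) + ((1 / g ^ 2 : ℝ) : ℂ) • Matrix.kroneckerMap (· * ·) (1 : Matrix (Finset (Orb (FermionTorus 2 L))) _ ℂ) (Matrix.diagonal fun k : GaugedHubbard.Bond L → Fin 2 × ZMod 4 => ∑ x : FermionTorus 2 L, (1 - (r (m (m (m (k (x, 0)) (k (x.shift 0, 1))) (iv (k (x.shift 1, 0)))) (iv (k (x, 1)))) 0 0 + r (m (m (m (k (x, 0)) (k (x.shift 0, 1))) (iv (k (x.shift 1, 0)))) (iv (k (x, 1)))) 1 1) / 2)); let P := ∑ b : GaugedHubbard.Bond L, (if b.2 = 0 then (1 : ℂ) else -1) • ∑ σ : Fin 2, ∑ τ : Fin 2, Matrix.kroneckerMap (· * ·) (annihilation (orb b.1 σ) * annihilation (orb (b.1.shift b.2) τ)) (Matrix.diagonal fun k : GaugedHubbard.Bond L → Fin 2 × ZMod 4 => if σ = 0 then r (k b) 1 τ else -r (k b) 0 τ); let p := fun ik : Finset (Orb (FermionTorus 2 L)) × (GaugedHubbard.Bond L → Fin 2 × ZMod 4) => ik.1.card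 = 2 * ⌊(1 - δ) * (L : ℝ) ^ 2 / 2⌋₊; ∀ ψ : {ik // p ik} → ℂ, (ψ ≠ 0 ∧ ∃ E : ℝ, H.toBlock p p *ᵥ ψ = (E : ℂ) • ψ ∧ ∀ φ : {ik // p ik} → ℂ, E * (star φ ⬝ᵥ φ).re ≤ (star φ ⬝ᵥ H.toBlock p p *ᵥ φ).re) → c' * (L : ℝ) ^ 4 * (star ψ ⬝ᵥ ψ).re ≤ (star ψ ⬝ᵥ (Pᴴ * P).toBlock p p *ᵥ ψ).re)) → ∃ g₁ : ℝ, 0 < g₁ ∧ ∃ c₁ : ℝ, 0 < c₁ ∧ ∃ κ : ℝ, 0 < κ ∧ ∃ L₂ : ℕ, (∀ g : ℝ, 0 < g → g ≤ g₁ → ∀ (L : ℕ) [NeZero L], L₂ ≤ L → Even L → (let m : Fin 2 × ZMod 4 → Fin 2 × ZMod 4 → Fin 2 × ZMod 4 := fun u v => (u.1 + v.1, if u.1 = 0 then (if v.1 = 0 then u.2 + v.2 else v.2 - u.2) else if v.1 = 0 then u.2 + v.2 else 2 + v.2 - u.2); let iv : Fin 2 × ZMod 4 → Fin 2 × ZMod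 4 := fun u => (u.1, if u.1 = 0 then -u.2 else u.2 + 2); let r : Fin 2 × ZMod 4 → Fin 2 → Fin 2 → ℂ := fun u σ τ => if u.1 = 0 then (if σ = τ then (if σ = 0 then Complex.I else -Complex.I) ^ u.2.val else 0) else if σ = τ then 0 else if σ = 0 then -(-Complex.I) ^ u.2.val else Complex.I ^ u.2.val; let hop := ∑ b : GaugedHubbard.Bond L, ∑ σ : Fin 2, ∑ τ : Fin 2, Matrix.kroneckerMap (· * ·) (creation (orb b.1 σ) * annihilation (orb (b.1.shift b.2) τ)) (Matrix.diagonal fun k : GaugedHubbard.Bond L → Fin 2 × ZMod 4 => r (k b) σ τ); let H := -(hop + hopᴴ) + ((U : ℝ) : ℂ) • Matrix.kroneckerMap (· * ·) (∑ x : FermionTorus 2 L, numberOp x 0 * numberOp x 1) (1 : Matrix (GaugedHubbard.Bond L → Fin 2 × ZMod 4) (GaugedHubbard.Bond L → Fin 2 × ZMod 4) ℂ) + ((g ^ 2 : ℝ) : ℂ) • Matrix.kroneckerMap (· * ·) (1 : Matrix (Finset (Orb (FermionTorus 2 L))) _ ℂ) (∑ b : GaugedHubbard.Bond L, Matrix.of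 fun k k' : GaugedHubbard.Bond L → Fin 2 × ZMod 4 => if k' = Function.update k b (k' b) then (if k b = k' b then (1 : ℂ) else 0) - 1 / 8 else 0) + ((1 / g ^ 2 : ℝ) : ℂ) • Matrix.kroneckerMap (· * ·) (1 : Matrix (Finset (Orb (FermionTorus 2 L))) _ ℂ) (Matrix.diagonal fun k : GaugedHubbard.Bond L → Fin 2 × ZMod 4 => ∑ x : FermionTorus 2 L, (1 - (r (m (m (m (k (x, 0)) (k (x.shift 0, 1))) (iv (k (x.shift 1, 0)))) (iv (k (x, 1)))) 0 0 + r (m (m (m (k (x, 0)) (k (x.shift 0, 1))) (iv (k (x.shift 1, 0)))) (iv (k (x, 1)))) 1 1) / 2)); let P := ∑ b : GaugedHubbard.Bond L, (if b.2 = 0 then (1 : ℂ) else -1) • ∑ σ : Fin 2, ∑ τ : Fin 2, Matrix.kroneckerMap (· * ·) (annihilation (orb b.1 σ) * annihilation (orb (b.1.shift b.2) τ)) (Matrix.diagonal fun k : GaugedHubbard.Bond L → Fin 2 × ZMod 4 => if σ = 0 then r (k b) 1 τ else -r (k b) 0 τ); let Hκ := H + ((κ / (L : ℝ) ^ 4 :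 ℝ) : ℂ) • (Pᴴ * P); let p := fun ik : Finset (Orb (FermionTorus 2 L)) × (GaugedHubbard.Bond L → Fin 2 × ZMod 4) => ik.1.card = 2 * ⌊(1 - δ) * (L : ℝ) ^ 2 / 2⌋₊; ∀ ψ : {ik // p ik} → ℂ, (ψ ≠ 0 ∧ ∃ E : ℝ, Hκ.toBlock p p *ᵥ ψ = (E : ℂ) • ψ ∧ ∀ φ : {ik // p ik} → ℂ, E * (star φ ⬝ᵥ φ).re ≤ (star φ ⬝ᵥ Hκ.toBlock p p *ᵥ φ).re) → c₁ * (L : ℝ) ^ 4 * (star ψ ⬝ᵥ ψ).re ≤ (star ψ ⬝ᵥ (Pᴴ * P).toBlock p p *ᵥ ψ).re))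

/-- STUB P2 SIGNATURE — VANISHING TWIST GAP (open, mild). Under the corridor antecedent at `(U,δ)`:
for every `ε > 0` and all large even `L`, no FLAT `Q₈` link configuration `k` (all plaquette
holonomies trivial: one of the 22 spin-twisted boundary conditions = abelian spin twists
`(m₁,m₂) ∈ ℤ₄²` up to sign and `SU(2)`) has an `N_L`-particle frozen-link Rayleigh quotient more than
`ε` below the `N_L`-block ground energy of the periodic torus: `e₀(periodic) − min_flat e₀(twisted) → 0`.
Why it might fail: if the ground state at `(U,δ)` is not pair-condensed on scale `L`, antiperiodic
(holonomy `−1`) sectors can undercut the periodic one by an `O(1)` shell energy along infinitely many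
even `L` (free fermions do; Lieb–Loss: the optimal cycle flux at half filling depends on `L mod 4`).
[cite: LiebLoss1993 (doi:10.1215/s0012-7094-93-07114-1)] [cite: Lieb1994] [cite: doi:10.1103/physrevb.62.7850] -/
def Sig.stub_twistGap : Prop :=
  open Literature.MathematicalPhysics.QuantumLattice in ∀ (U δ g₀ c' : ℝ) (L₁ : ℕ), 0 < U → δ ∈ Set.Ioo (0 : ℝ) (1 / 2) → 0 < g₀ → 0 < c' → (∀ g : ℝ, 0 < g → g ≤ g₀ → ∀ (L : ℕ) [NeZero L], L₁ ≤ L → Even L → (let m : Fin 2 × ZMod 4 → Fin 2 × ZMod 4 → Fin 2 × ZMod 4 := fun u v => (u.1 + v.1, if u.1 = 0 then (if v.1 = 0 then u.2 + v.2 else v.2 - u.2) else if v.1 = 0 then u.2 + v.2 else 2 + v.2 - u.2); let iv : Fin 2 × ZMod 4 → Fin 2 × ZMod 4 := fun u => (u.1, if u.1 = 0 then -u.2 else u.2 + 2); let r : Fin 2 × ZMod 4 → Fin 2 → Fin 2 → ℂ := fun u σ τ => if u.1 = 0 then (if σ = τ then (if σ = 0 then Complex.I else -Complex.I) ^ u.2.val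 else 0) else if σ = τ then 0 else if σ = 0 then -(-Complex.I) ^ u.2.val else Complex.I ^ u.2.val; let hop := ∑ b : GaugedHubbard.Bond L, ∑ σ : Fin 2, ∑ τ : Fin 2, Matrix.kroneckerMap (· * ·) (creation (orb b.1 σ) * annihilation (orb (b.1.shift b.2) τ)) (Matrix.diagonal fun k : GaugedHubbard.Bond L → Fin 2 × ZMod 4 => r (k b) σ τ); let H := -(hop + hopᴴ) + ((U : ℝ) : ℂ) • Matrix.kroneckerMap (· * ·) (∑ x : FermionTorus 2 L, numberOp x 0 * numberOp x 1) (1 : Matrix (GaugedHubbard.Bond L → Fin 2 × ZMod 4) (GaugedHubbard.Bond L → Fin 2 × ZMod 4) ℂ) + ((g ^ 2 : ℝ) : ℂ) • Matrix.kroneckerMap (· * ·) (1 : Matrix (Finset (Orb (FermionTorus 2 L))) _ ℂ) (∑ b : GaugedHubbard.Bond L, Matrix.of fun k k' : GaugedHubbard.Bond L → Fin 2 × ZMod 4 => if k' = Function.update k b (k' b) then (if k b = k' b then (1 : ℂ) else 0) - 1 / 8 else 0) + ((1 / g ^ 2 : ℝ) : ℂ) • Matrix.kroneckerMap (· * ·)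 (1 : Matrix (Finset (Orb (FermionTorus 2 L))) _ ℂ) (Matrix.diagonal fun k : GaugedHubbard.Bond L → Fin 2 × ZMod 4 => ∑ x : FermionTorus 2 L, (1 - (r (m (m (m (k (x, 0)) (k (x.shift 0, 1))) (iv (k (x.shift 1, 0)))) (iv (k (x, 1)))) 0 0 + r (m (m (m (k (x, 0)) (k (x.shift 0, 1))) (iv (k (x.shift 1, 0)))) (iv (k (x, 1)))) 1 1) / 2)); let P := ∑ b : GaugedHubbard.Bond L, (if b.2 = 0 then (1 : ℂ) else -1) • ∑ σ : Fin 2, ∑ τ : Fin 2, Matrix.kroneckerMap (· * ·) (annihilation (orb b.1 σ) * annihilation (orb (b.1.shift b.2) τ)) (Matrix.diagonal fun k : GaugedHubbard.Bond L → Fin 2 × ZMod 4 => if σ = 0 then r (k b) 1 τ else -r (k b) 0 τ); let p := fun ik : Finset (Orb (FermionTorus 2 L)) × (GaugedHubbard.Bond L → Fin 2 × ZMod 4) => ik.1.card = 2 * ⌊(1 - δ) * (L : ℝ) ^ 2 / 2⌋₊; ∀ ψ : {ik // p ik} → ℂ, (ψ ≠ 0 ∧ ∃ E : ℝ, H.toBlock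 p p *ᵥ ψ = (E : ℂ) • ψ ∧ ∀ φ : {ik // p ik} → ℂ, E * (star φ ⬝ᵥ φ).re ≤ (star φ ⬝ᵥ H.toBlock p p *ᵥ φ).re) → c' * (L : ℝ) ^ 4 * (star ψ ⬝ᵥ ψ).re ≤ (star ψ ⬝ᵥ (Pᴴ * P).toBlock p p *ᵥ ψ).re)) → ∀ ε : ℝ, 0 < ε → ∃ L₃ : ℕ, (∀ (L : ℕ) [NeZero L], L₃ ≤ L → Even L → (let m : Fin 2 × ZMod 4 → Fin 2 × ZMod 4 → Fin 2 × ZMod 4 := fun u v => (u.1 + v.1, if u.1 = 0 then (if v.1 = 0 then u.2 + v.2 else v.2 - u.2) else if v.1 = 0 then u.2 + v.2 else 2 + v.2 - u.2); let iv : Fin 2 × ZMod 4 → Fin 2 × ZMod 4 := fun u => (u.1, if u.1 = 0 then -u.2 else u.2 + 2); let r : Fin 2 × ZMod 4 → Fin 2 → Fin 2 → ℂ := fun u σ τ => if u.1 = 0 then (if σ = τ then (if σ = 0 then Complex.I else -Complex.I) ^ u.2.val else 0) else if σ = τ then 0 else if σ = 0 then -(-Complex.I) ^ u.2.val else Complex.I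 ^ u.2.val; ∀ k : GaugedHubbard.Bond L → Fin 2 × ZMod 4, (∀ x : FermionTorus 2 L, m (m (m (k (x, 0)) (k (x.shift 0, 1))) (iv (k (x.shift 1, 0)))) (iv (k (x, 1))) = ((0 : Fin 2), (0 : ZMod 4))) → (let hopF := ∑ b : GaugedHubbard.Bond L, ∑ σ : Fin 2, ∑ τ : Fin 2, r (k b) σ τ • (creation (orb b.1 σ) * annihilation (orb (b.1.shift b.2) τ)); let A := -(hopF + hopFᴴ) + ((U : ℝ) : ℂ) • ∑ x : FermionTorus 2 L, numberOp x 0 * numberOp x 1; ∀ φ : Fock (Orb (FermionTorus 2 L)), φ ∈ (nParticleSubmodule (2 * ⌊(1 - δ) * (L : ℝ) ^ 2 / 2⌋₊) : Submodule ℂ (Fock (Orb (FermionTorus 2 L)))) → ((hubbardTorus 2 L 1 U).minEnergyOn (nParticleSubmodule (2 * ⌊(1 - δ) * (L : ℝ) ^ 2 / 2⌋₊) : Submodule ℂ (Fock (Orb (FermionTorus 2 L)))) - (ε)) * (star φ ⬝ᵥ φ).re ≤ (star φ ⬝ᵥ A *ᵥ φ).re)))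

/-- STUB P3 SIGNATURE — PENALISED ENDPOINT (PROVABLE NOW; finite-dimensional; size XL). Penalised
corridor order at `(g₁,c₁,κ,L₂)` and twist gap `≤ κc₁/2` from `L₃` on ⇒ for some `a > 0` (indeed
`a = c₁`) every normalised `(N_L,S^z=0)`-sector ground state `ψ` of `hubbardTorus 2 L 1 U` has
`a·L⁴ ≤ Re⟨ψ, Δ_d†Δ_d ψ⟩` at every large even `L`. Proof route: (1) `e(κ) ≤ E₀^N(H_g+κY) ≤ e(κ) +`
`(7/8)g²|Bond L|` for `g ≤ g_*` (trial state `φ ⊗ e_k` at a flat minimiser; lower bound drops `g²E ≥ 0`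
and uses block-diagonality of `A + κY + g⁻²M`, magnetic weight `≥ 1` off flat); (2) sandwich with a
ground state `χ` of the penalised block: `E₀(H_g+κY) ≥ E₀(H_g) + κc₁ ≥ e(0) + κc₁`; (3) `g → 0⁺`:
`e(κ) ≥ e(0) + κc₁`; (4) trivial class `k ≡ 1` is flat, `H_F(1) = hubbardTorus` (`L ≥ 3`,
`spinGaugedHubbardTorusWith_apply_one_one` at `gE = gB = 0`), so for a sector ground state `ψ`
(sector energy = `N`-block energy, `groundEnergyAt_eq_minEnergyOn_szSector`):
`E_per + κ⟨Y_1⟩_ψ ≥ h(1,κ) ≥ e(κ) ≥ e(0) + κc₁ ≥ E_per − κc₁/2 + κc₁`; (5) `P_1 = Δ_d/√2`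
(`spinGaugedPairField_apply_one_one`). Why it might fail: only by a convention slip (the `L ≥ 3`
dictionary, the factor `1/2`) — absorbed by `∃ a`. [cite: KaplanHorschVonDerLinden1989]
[cite: doi:10.1103/physrevd.11.395] [cite: Scalapino1995, §2] -/
def Sig.stub_penalisedEndpoint : Prop :=
  open Literature.MathematicalPhysics.QuantumLattice in ∀ (U δ g₁ c₁ κ : ℝ) (L₂ L₃ : ℕ), 0 < U → δ ∈ Set.Ioo (0 : ℝ) (1 / 2) → 0 < g₁ → 0 < c₁ → 0 < κ → (∀ g : ℝ, 0 < g → g ≤ g₁ → ∀ (L : ℕ) [NeZero L], L₂ ≤ L → Even L → (let m : Fin 2 × ZMod 4 → Fin 2 × ZMod 4 → Fin 2 × ZMod 4 := fun u v => (u.1 + v.1, if u.1 = 0 then (if v.1 = 0 then u.2 + v.2 else v.2 - u.2) else if v.1 = 0 then u.2 + v.2 else 2 + v.2 - u.2); let iv : Fin 2 × ZMod 4 → Fin 2 × ZMod 4 := fun u => (u.1, if u.1 = 0 then -u.2 else u.2 + 2); let r : Fin 2 × ZMod 4 → Fin 2 → Fin 2 → ℂ := fun u σ τ => if u.1 = 0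 then (if σ = τ then (if σ = 0 then Complex.I else -Complex.I) ^ u.2.val else 0) else if σ = τ then 0 else if σ = 0 then -(-Complex.I) ^ u.2.val else Complex.I ^ u.2.val; let hop := ∑ b : GaugedHubbard.Bond L, ∑ σ : Fin 2, ∑ τ : Fin 2, Matrix.kroneckerMap (· * ·) (creation (orb b.1 σ) * annihilation (orb (b.1.shift b.2) τ)) (Matrix.diagonal fun k : GaugedHubbard.Bond L → Fin 2 × ZMod 4 => r (k b) σ τ); let H := -(hop + hopᴴ) + ((U : ℝ) : ℂ) • Matrix.kroneckerMap (· * ·) (∑ x : FermionTorus 2 L, numberOp x 0 * numberOp x 1) (1 : Matrix (GaugedHubbard.Bond L → Fin 2 × ZMod 4) (GaugedHubbard.Bond L → Fin 2 × ZMod 4) ℂ) + ((g ^ 2 : ℝ) : ℂ) • Matrix.kroneckerMap (· * ·) (1 : Matrix (Finset (Orb (FermionTorus 2 L))) _ ℂ) (∑ b : GaugedHubbard.Bond L, Matrix.of fun k k' : GaugedHubbard.Bond L → Fin 2 × ZMod 4 => if k' = Function.update k b (k' b) then (if k b = k' b then (1 : ℂ) else 0) - 1 / 8 else 0) + ((1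 / g ^ 2 : ℝ) : ℂ) • Matrix.kroneckerMap (· * ·) (1 : Matrix (Finset (Orb (FermionTorus 2 L))) _ ℂ) (Matrix.diagonal fun k : GaugedHubbard.Bond L → Fin 2 × ZMod 4 => ∑ x : FermionTorus 2 L, (1 - (r (m (m (m (k (x, 0)) (k (x.shift 0, 1))) (iv (k (x.shift 1, 0)))) (iv (k (x, 1)))) 0 0 + r (m (m (m (k (x, 0)) (k (x.shift 0, 1))) (iv (k (x.shift 1, 0)))) (iv (k (x, 1)))) 1 1) / 2)); let P := ∑ b : GaugedHubbard.Bond L, (if b.2 = 0 then (1 : ℂ) else -1) • ∑ σ : Fin 2, ∑ τ : Fin 2, Matrix.kroneckerMap (· * ·) (annihilation (orb b.1 σ) * annihilation (orb (b.1.shift b.2) τ)) (Matrix.diagonal fun k : GaugedHubbard.Bond L → Fin 2 × ZMod 4 => if σ = 0 then r (k b) 1 τ else -r (k b) 0 τ); let Hκ := H + ((κ / (L : ℝ) ^ 4 : ℝ) : ℂ) • (Pᴴ * P); let p := fun ik : Finset (Orb (FermionTorus 2 L)) × (GaugedHubbard.Bond L → Fin 2 × ZMod 4) => ik.1.card = 2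 * ⌊(1 - δ) * (L : ℝ) ^ 2 / 2⌋₊; ∀ ψ : {ik // p ik} → ℂ, (ψ ≠ 0 ∧ ∃ E : ℝ, Hκ.toBlock p p *ᵥ ψ = (E : ℂ) • ψ ∧ ∀ φ : {ik // p ik} → ℂ, E * (star φ ⬝ᵥ φ).re ≤ (star φ ⬝ᵥ Hκ.toBlock p p *ᵥ φ).re) → c₁ * (L : ℝ) ^ 4 * (star ψ ⬝ᵥ ψ).re ≤ (star ψ ⬝ᵥ (Pᴴ * P).toBlock p p *ᵥ ψ).re)) → (∀ (L : ℕ) [NeZero L], L₃ ≤ L → Even L → (let m : Fin 2 × ZMod 4 → Fin 2 × ZMod 4 → Fin 2 × ZMod 4 := fun u v => (u.1 + v.1, if u.1 = 0 then (if v.1 = 0 then u.2 + v.2 else v.2 - u.2) else if v.1 = 0 then u.2 + v.2 else 2 + v.2 - u.2); let iv : Fin 2 × ZMod 4 → Fin 2 × ZMod 4 := fun u => (u.1, if u.1 = 0 then -u.2 else u.2 + 2); let r : Fin 2 × ZMod 4 → Fin 2 → Fin 2 → ℂ := fun u σ τ => if u.1 = 0 then (if σ = τ then (if σ = 0 then Complex.I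 else -Complex.I) ^ u.2.val else 0) else if σ = τ then 0 else if σ = 0 then -(-Complex.I) ^ u.2.val else Complex.I ^ u.2.val; ∀ k : GaugedHubbard.Bond L → Fin 2 × ZMod 4, (∀ x : FermionTorus 2 L, m (m (m (k (x, 0)) (k (x.shift 0, 1))) (iv (k (x.shift 1, 0)))) (iv (k (x, 1))) = ((0 : Fin 2), (0 : ZMod 4))) → (let hopF := ∑ b : GaugedHubbard.Bond L, ∑ σ : Fin 2, ∑ τ : Fin 2, r (k b) σ τ • (creation (orb b.1 σ) * annihilation (orb (b.1.shift b.2) τ)); let A := -(hopF + hopFᴴ) + ((U : ℝ) : ℂ) • ∑ x : FermionTorus 2 L, numberOp x 0 * numberOp x 1; ∀ φ : Fock (Orb (FermionTorus 2 L)), φ ∈ (nParticleSubmodule (2 * ⌊(1 - δ) * (L : ℝ) ^ 2 / 2⌋₊) : Submodule ℂ (Fock (Orb (FermionTorus 2 L)))) → ((hubbardTorus 2 L 1 U).minEnergyOn (nParticleSubmodule (2 * ⌊(1 - δ) * (L : ℝ) ^ 2 / 2⌋₊) : Submodule ℂ (Fock (Orb (FermionTorus 2 L)))) - (κ * c₁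 / 2)) * (star φ ⬝ᵥ φ).re ≤ (star φ ⬝ᵥ A *ᵥ φ).re))) → ∃ a : ℝ, 0 < a ∧ ∃ L₄ : ℕ, (∀ (L : ℕ) [NeZero L], L₄ ≤ L → Even L → ∀ ψ : Fock (Orb (FermionTorus 2 L)), star ψ ⬝ᵥ ψ = 1 → IsGroundStateInSector (hubbardTorus 2 L 1 U) (2 * ⌊(1 - δ) * (L : ℝ) ^ 2 / 2⌋₊) 0 ψ → a * (L : ℝ) ^ 4 ≤ (expect ((pairField dWaveFormFactor L)ᴴ * pairField dWaveFormFactor L) ψ).re)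

end Verbatim

/-! ## Registered stubs (the ONLY `sorry`s of this file) -/

/-- Registered stub P1 (penalty upgrade on the gauged side — the bet). -/
theorem stub_penaltyUpgrade : Sig.stub_penaltyUpgrade := by
  sorry

/-- Registered stub P2 (vanishing twist gap). -/
theorem stub_twistGap : Sig.stub_twistGap := by
  sorry

/-- Registered stub P3 (penalised endpoint — provable now). -/
theorem stub_penalisedEndpoint : Sig.stub_penalisedEndpoint := by
  sorry

/-! ## Composition (sorry-free) -/

open Literature.MathematicalPhysics.QuantumLattice (hasLongRangeOrder_even_of_le sum_pairFieldCorr_succ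
  dWaveFormFactor)

/-- **THE SKELETON THEOREM.** `Sig.stub_penaltyUpgrade → Sig.stub_twistGap → Sig.stub_penalisedEndpoint →`
`Theses.ColourTheSpin.SgEndpoint` (a real proof): at `(U,δ)` P1 turns the corridor antecedent into
penalised corridor order at some `(g₁,c₁,κ,L₂)`, P2 gives the twist gap `≤ κc₁/2` from some `L₃`, P3
every-ground-state finite-volume order `a·L⁴`, and the landed `hasLongRangeOrder_even_of_le` +
`sum_pairFieldCorr_succ` the summit's matrix. Every stub is consumed. [folklore] -/
theorem SgEndpoint_of :
    Sig.stub_penaltyUpgrade → Sig.stub_twistGap → Sig.stub_penalisedEndpoint →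
      Summit.HubbardSuperconductivity.HubbardSuperconductivity.Theses.ColourTheSpin.SgEndpoint := by
  intro h1 h3 h2
  unfold Summit.HubbardSuperconductivity.HubbardSuperconductivity.Theses.ColourTheSpin.SgEndpoint
  intro U δ g₀ c' L₁ hU hδ hg hc hC N ψ hadm
  obtain ⟨g₁, hg₁, c₁, hc₁, κ, hκ, L₂, hP⟩ := h1 U δ g₀ c' L₁ hU hδ hg hc hC
  obtain ⟨L₃, hT⟩ := h3 U δ g₀ c' L₁ hU hδ hg hc hC (κ * c₁ / 2) (by positivity)
  obtain ⟨a, ha, L₄, hE⟩ := h2 U δ g₁ c₁ κ L₂ L₃ hU hδ hg₁ hc₁ hκ hP hT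
  refine hasLongRangeOrder_even_of_le dWaveFormFactor ψ (fun n hn => (hadm (n + 1) hn).2.1) ha L₄
    (fun n hn hK => ?_)
  rw [sum_pairFieldCorr_succ dWaveFormFactor ψ n]
  obtain ⟨hNn, hnorm, hgs⟩ := hadm (n + 1) hn
  rw [hNn] at hgs
  exact hE (n + 1) hK hn (ψ (n + 1)) hnorm hgs

/-- The skeleton in its final shape: the crux BY NAME from the three registered stubs (depends on
`sorryAx` through the stubs only). [folklore] -/
theorem SgEndpoint_proof :
    Summit.HubbardSuperconductivity.HubbardSuperconductivity.Theses.ColourTheSpin.SgEndpoint :=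
  SgEndpoint_of stub_penaltyUpgrade stub_twistGap stub_penalisedEndpoint

end Summit.HubbardSuperconductivity.HubbardSuperconductivity.Cruxes.SgEndpoint.PenaltyChord

end
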